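import Summits.CriticalPhenomena.PercolationContinuityZ3.Theorems.PercNearOneGluingNoHeavyLowerTailSahiCombNCopyBridge
import Summits.CriticalPhenomena.PercolationContinuityZ3.Theorems.PercNearOneGluingNoHeavyLowerTailSahiCombSymmetry

/-!
# The comb (tensor-Bernstein) hierarchy for Sahi's `E_k`, XI: a KERNEL-CHECKABLE test of the typed shape laws (ENDMIN, ORDER-1, UNI)
# for all `n`-tuples of up-sets of a cube `{0,1}^m`, every order `n` — soundness

Support file of the one-cut programme (crux `NoHeavyLowerTail`, stmt-CriticalPhenomena-4575; cell `prim-masterthm`, seat P5).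
The typed shape laws of `…SahiCombShape` (`CombEndMin`, `CombOrderOne`, `CombUnimodal`) are conjectures of ours, census-clean outside the
kernel (P5 report §7.4).  With the computable mirror `NCopyCert.sahiCoef = SahiComb.combCoeff` (`…SahiCombNCopyBridge`) and prim-l12 P5's
Kronecker arithmetic (`NCopyCert.sahiKr`, digit base `2^σ`, positions in base `n+1`), every coefficient LINE of every tuple of cube events
is a run of base-`2^σ` digits of one natural number, so the laws become a finite digit scan:

* `SahiComb.endMinB`, `ordOneB`, `uniB` — the three laws on a digit line `t ↦ g t`, `t ≤ n`, as Booleans, with their specifications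
  (`uniB`: "no strict descent followed by a strict ascent", equivalent to unimodality — `unimodal_of_noDescAsc`);
* `SahiComb.checkShapeFam σ m n KT F off a` — the scan of all `m·(n+1)^{m−1}` lines of one family of bitmasks; `SahiComb.checkShapeCube` — over
  all `n`-tuples of increasing bitmasks of the `m`-cube (`SahiC3Cube.upsN`);
* **`SahiComb.shape_of_checkShapeCube`** — SOUNDNESS: if `coefBound m n < 2^(σ−1)` and the cube scan passes, then for EVERY `n`-tuple of
  increasing events of `2^{Fin m}`, every axis and every profile, the coefficient line `combLine n U e j` satisfies ENDMIN
  (`min(c_0,c_n) ≤ c_t`), ORDER-1 (`c_0 ≤ c_1`, `c_n ≤ c_{n−1}`) and UNI (`∃ m, ↗ on [0,m], ↘ on [m,n]`) — the conclusions of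
  `CombEndMin n` / `CombOrderOne n` / `CombUnimodal n` on that cube (exact digit extraction `digit_eq_sahiCoef_add`).
The evaluations (kernel `decide` for small cells, `native_decide` for larger ones) are in the companion `…SahiCombShapeCells`.
Everything here is proved; axioms standard. [this work]
-/

noncomputable section

open scoped Classical

namespace Summit.CriticalPhenomena.PercolationContinuityZ3.Theorems

open Finset Function
open Literature.Combinatorics.Sahi2008
open Literature.Probability.Percolation.DecisionTree (ind)
open SahiComb SahiC3Cube NCopyCert OneCutCert

namespace SahiComb

/-! ### Shape laws on a digit line, as Booleans -/

/-- ENDMIN on `g 0, …, g n`: every entry is `≥ min (g 0) (g n)`. [this work] -/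
def endMinB (n : ℕ) (g : ℕ → ℕ) : Bool := (List.range (n + 1)).all fun t => decide (min (g 0) (g n) ≤ g t)

/-- ORDER-1 on `g 0, …, g n`: `g 0 ≤ g 1` and `g n ≤ g (n−1)`. [this work] -/
def ordOneB (n : ℕ) (g : ℕ → ℕ) : Bool := decide (g 0 ≤ g 1) && decide (g n ≤ g (n - 1))

/-- UNI on `g 0, …, g n`: no strict descent at a step `i` followed by a strict ascent at a later step `j < n`. [this work] -/
def uniB (n : ℕ) (g : ℕ → ℕ) : Bool :=
  (List.range n).all fun i => (List.range n).all fun j =>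
    !(decide (i < j) && decide (g (i + 1) < g i) && decide (g j < g (j + 1)))

/-- Specification of `endMinB`. [this work] -/
theorem endMinB_spec {n : ℕ} {g : ℕ → ℕ} (h : endMinB n g = true) {t : ℕ} (ht : t ≤ n) : min (g 0) (g n) ≤ g t := by
  unfold endMinB at h
  rw [List.all_eq_true] at h
  have := h t (List.mem_range.2 (Nat.lt_succ_of_le ht))
  exact of_decide_eq_true this

/-- Specification of `ordOneB`. [this work] -/
theorem ordOneB_spec {n : ℕ} {g : ℕ → ℕ} (h : ordOneB n g = true) : g 0 ≤ g 1 ∧ g n ≤ g (n - 1) := by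
  unfold ordOneB at h
  simp only [Bool.and_eq_true, decide_eq_true_eq] at h
  exact h

/-- Specification of `uniB`. [this work] -/
theorem uniB_spec {n : ℕ} {g : ℕ → ℕ} (h : uniB n g = true) {i j : ℕ} (hij : i < j) (hj : j < n) :
    ¬ (g (i + 1) < g i ∧ g j < g (j + 1)) := by
  unfold uniB at h
  rw [List.all_eq_true] at h
  have h1 := h i (List.mem_range.2 (hij.trans hj))
  rw [List.all_eq_true] at h1
  have h2 := h1 j (List.mem_range.2 hj)
  simp only [Bool.not_eq_true', Bool.and_eq_false_iff, decide_eq_false_iff_not] at h2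
  rintro ⟨hd, ha⟩
  rcases h2 with (h2 | h2) | h2
  · exact h2 hij
  · exact h2 hd
  · exact h2 ha

/-! ### Unimodality from "no descent before an ascent" -/

/-- Monotonicity on a bounded interval of `ℕ` from the successor steps. [folklore] -/
theorem monotoneOn_Icc_of_le_succ {β : Type*} [Preorder β] {f : ℕ → β} {a b : ℕ}
    (h : ∀ i, a ≤ i → i < b → f i ≤ f (i + 1)) : MonotoneOn f (Set.Icc a b) := by
  intro s hs t ht hst
  have key : ∀ d, s + d ≤ b → f s ≤ f (s + d) := by
    intro d
    induction d with
    | zero => intro _; simp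
    | succ d ih =>
      intro hd
      exact (ih (by omega)).trans (by rw [← add_assoc]; exact h _ (by have := hs.1; omega) (by omega))
  have := key (t - s) (by rw [Nat.add_sub_cancel' hst]; exact ht.2)
  rwa [Nat.add_sub_cancel' hst] at this

/-- Antitonicity on a bounded interval of `ℕ` from the successor steps. [folklore] -/
theorem antitoneOn_Icc_of_succ_le {β : Type*} [Preorder β] {f : ℕ → β} {a b : ℕ}
    (h : ∀ i, a ≤ i → i < b → f (i + 1) ≤ f i) : AntitoneOn f (Set.Icc a b) :=
  fun _ hs _ ht hst => monotoneOn_Icc_of_le_succ (β := βᵒᵈ) h hs ht hst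

/-- **A sequence with no strict descent followed by a strict ascent is unimodal** (mode = first descent, or the right end). [this work] -/
theorem unimodal_of_noDescAsc {β : Type*} [LinearOrder β] (L : ℕ → β) (n : ℕ)
    (h : ∀ i j, i < j → j < n → ¬ (L (i + 1) < L i ∧ L j < L (j + 1))) :
    ∃ mo, mo ≤ n ∧ MonotoneOn L (Set.Icc 0 mo) ∧ AntitoneOn L (Set.Icc mo n) := by
  by_cases hS : ∃ i, i < n ∧ L (i + 1) < L i
  · let mo := Nat.find hS
    have hmo : mo < n ∧ L (mo + 1) < L mo := Nat.find_spec hS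
    have hmin : ∀ i, i < mo → ¬ (i < n ∧ L (i + 1) < L i) := fun i hi => Nat.find_min hS hi
    refine ⟨mo, hmo.1.le, monotoneOn_Icc_of_le_succ fun i _ hi => ?_, antitoneOn_Icc_of_succ_le fun i hi hin => ?_⟩
    · exact not_lt.1 fun hlt => hmin i hi ⟨hi.trans hmo.1, hlt⟩
    · rcases hi.eq_or_lt with h0 | h0
      · rw [← h0]; exact hmo.2.le
      · exact not_lt.1 fun hlt => h mo i h0 hin ⟨hmo.2, hlt⟩
  · push Not at hS
    exact ⟨n, le_rfl, monotoneOn_Icc_of_le_succ fun i _ hi => hS i hi, antitoneOn_Icc_of_succ_le fun i hi hin => by omega⟩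

/-! ### The scan of one family and of the cube -/

/-- **Shape scan of one family of bitmasks** `a : Fin n → ℕ` of the `m`-cube: with `Z = sahiKr a + offset` (the offset Kronecker number of
the comb array, digits = coefficients `+ 2^(σ−1)`), check `Z ≥ 0` and, for every axis `e < m` and every position `p₀` whose `e`-digit
(base `n+1`) is `0`, the laws ENDMIN, ORDER-1, UNI on the digit line `t ↦ digit (2^σ) Z (p₀ + t·(n+1)^e)`. [this work] -/
def checkShapeFam (σ m n : ℕ) (KT : ℕ → ℤ) (F off : ℤ) (a : Fin n → ℕ) : Bool :=
  let Z := sahiKr KT F n a + off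
  decide (0 ≤ Z) &&
    (List.range m).all fun e =>
      (List.range ((n + 1) ^ m)).all fun p₀ =>
        (!decide (p₀ / (n + 1) ^ e % (n + 1) = 0)) ||
          (endMinB n (fun t => digit (2 ^ σ) Z.toNat (p₀ + t * (n + 1) ^ e)) &&
            ordOneB n (fun t => digit (2 ^ σ) Z.toNat (p₀ + t * (n + 1) ^ e)) &&
            uniB n (fun t => digit (2 ^ σ) Z.toNat (p₀ + t * (n + 1) ^ e)))

/-- All `n`-tuples with entries from a list. [folklore] -/
def tuples (l : List ℕ) : (n : ℕ) → List (Fin n → ℕ)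
  | 0 => [Fin.elim0]
  | n + 1 => l.flatMap fun x => (tuples l n).map fun a => Fin.cons x a

/-- Every tuple with entries in the list is enumerated. [folklore] -/
theorem mem_tuples {l : List ℕ} : ∀ {n : ℕ} (a : Fin n → ℕ), (∀ i, a i ∈ l) → a ∈ tuples l n
  | 0, a, _ => by
    have : a = Fin.elim0 := funext fun i => i.elim0
    simp [tuples, this]
  | n + 1, a, ha => by
    simp only [tuples, List.mem_flatMap, List.mem_map]
    exact ⟨a 0, ha 0, Fin.tail a, mem_tuples _ fun i => ha i.succ, Fin.cons_self_tail a⟩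

/-- **Shape scan of the whole cube**: every `n`-tuple of increasing bitmasks of the `m`-cube passes `checkShapeFam`. [this work] -/
def checkShapeCube (σ m n : ℕ) (KT : ℕ → ℤ) (F off : ℤ) : Bool :=
  (tuples (upsN m) n).all (checkShapeFam σ m n KT F off)

/-! ### Soundness -/

/-- `combLine` unfolded with the ambient `DecidableEq` instance (the definition carries the classical one). [this work] -/
theorem combLine_eq_combCoeff {ι : Type*} [Fintype ι] [DecidableEq ι] {k : ℕ} (U : Fin k → Set (Set ι)) (e : ι) (j : ι → ℕ)
    (t : ℕ) : combLine k U e j t = combCoeff k (fun i => ind (U i)) (update j e t) := by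
  unfold combLine
  congr 1
  funext i
  simp only [update_apply]
  split_ifs <;> rfl

variable {m n : ℕ}

/-- Position (base `n+1`) of a key: Mathlib's `finFunctionFinEquiv`. -/
private theorem pos_update (K : Fin m → Fin (n + 1)) (e : Fin m) (x : Fin (n + 1)) :
    (finFunctionFinEquiv (update K e x) : ℕ) + (K e : ℕ) * (n + 1) ^ (e : ℕ) =
      (finFunctionFinEquiv K : ℕ) + (x : ℕ) * (n + 1) ^ (e : ℕ) := by
  rw [finFunctionFinEquiv_apply, finFunctionFinEquiv_apply, ← Finset.add_sum_erase _ _ (mem_univ e),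
    ← Finset.add_sum_erase univ (fun i => (K i : ℕ) * (n + 1) ^ (i : ℕ)) (mem_univ e), update_self]
  have hrest : ∑ i ∈ univ.erase e, ((update K e x i : Fin (n + 1)) : ℕ) * (n + 1) ^ (i : ℕ) =
      ∑ i ∈ univ.erase e, (K i : ℕ) * (n + 1) ^ (i : ℕ) :=
    sum_congr rfl fun i hi => by rw [update_of_ne (ne_of_mem_erase hi)]
  rw [hrest]
  ring

/-- The base-`(n+1)` digit `e` of the position of a key is the key's `e`-entry. [this work] -/
theorem digit_pos_eq (K : Fin m → Fin (n + 1)) (e : Fin m) : digit (n + 1) (finFunctionFinEquiv K : ℕ) e = K e := by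
  rw [finFunctionFinEquiv_apply]
  exact digit_of_sum (n + 1) (Nat.succ_pos n) m (fun i => (K i : ℕ)) (fun i => (K i).2) e

/-- **Exact digit extraction**: with `N = (sahiKr a + maskN)⁺` and the coefficient bound, the base-`2^σ` digit of `N` at the position of
the key `K` is `sahiCoef … K + 2^(σ−1)`. [this work] -/
theorem digit_eq_sahiCoef_add {σ : ℕ} (hσ : 0 < σ) (hbnd : coefBound m n < 2 ^ (σ - 1)) {KT : ℕ → ℤ}
    (hKT : ∀ T, KT T = (krTB σ (n + 1) m T : ℤ)) (a : Fin n → ℕ)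
    (hZ : 0 ≤ sahiKr KT (krTB σ (n + 1) m (fullN m)) n a + (maskN σ ((n + 1) ^ m) : ℤ)) (K : Fin m → Fin (n + 1)) :
    ((digit (2 ^ σ) (sahiKr KT (krTB σ (n + 1) m (fullN m)) n a + (maskN σ ((n + 1) ^ m) : ℤ)).toNat
        (finFunctionFinEquiv K) : ℕ) : ℤ) = sahiCoef m n a K + 2 ^ (σ - 1) := by
  set c := sahiCoef m n a with hc
  have hB : ∀ k, |c k| < 2 ^ (σ - 1) := fun k => lt_of_le_of_lt (abs_sahiCoef_le n _ k) (by exact_mod_cast hbnd)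
  set N : ℕ := (sahiKr KT (krTB σ (n + 1) m (fullN m)) n a + (maskN σ ((n + 1) ^ m) : ℤ)).toNat with hN
  have hNZ : (N : ℤ) = krB (n + 1) (2 ^ σ) n c + ∑ j : Fin ((n + 1) ^ m), (2 : ℤ) ^ (σ - 1) * (2 ^ σ) ^ (j : ℕ) := by
    rw [hN, Int.toNat_of_nonneg hZ, hc, krB_sahiCoef σ (n + 1) hKT, maskN_eq_sum σ hσ,
      Fin.sum_univ_eq_sum_range (fun j => (2 : ℤ) ^ (σ - 1) * (2 ^ σ) ^ j) ((n + 1) ^ m)]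
  -- as in `NCopyCert.coef_nonneg_of_digit_ge`: `N = Σ_j dg_j (2^σ)^j` with `dg_j = c + 2^(σ−1) < 2^σ`
  have hK2 : (2 : ℕ) ^ σ = 2 * 2 ^ (σ - 1) := by rw [← pow_succ']; congr 1; omega
  let dg : Fin ((n + 1) ^ m) → ℕ := fun j => (c (finFunctionFinEquiv.symm j) + 2 ^ (σ - 1)).toNat
  have hdnn : ∀ k, 0 ≤ c k + 2 ^ (σ - 1) := fun k => by have := (abs_lt.1 (hB k)).1; linarith
  have hK2z : (2 : ℤ) ^ σ = 2 * 2 ^ (σ - 1) := by exact_mod_cast hK2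
  have hdlt : ∀ j, dg j < 2 ^ σ := fun j => by
    have h1 := (abs_lt.1 (hB (finFunctionFinEquiv.symm j))).2
    have h2 := hdnn (finFunctionFinEquiv.symm j)
    have h3 : ((dg j : ℕ) : ℤ) < (2 : ℤ) ^ σ := by
      simp only [dg]
      rw [Int.toNat_of_nonneg h2, hK2z]
      linarith
    exact_mod_cast h3
  have hNsum : N = ∑ j : Fin ((n + 1) ^ m), dg j * (2 ^ σ) ^ (j : ℕ) := by
    zify
    rw [hNZ]
    unfold krB
    rw [← (Equiv.sum_comp finFunctionFinEquiv.symm (fun k => c k * ((2 ^ σ : ℕ) : ℤ) ^ posB (n + 1) k)),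
      ← Finset.sum_add_distrib]
    refine Finset.sum_congr rfl fun j _ => ?_
    have hEj : posB (n + 1) (finFunctionFinEquiv.symm j) = (j : ℕ) := by rw [posB_eq, Equiv.apply_symm_apply]
    rw [hEj]
    simp only [dg]
    rw [Int.toNat_of_nonneg (hdnn _)]
    push_cast
    ring
  have hdd := digit_of_sum _ (pow_pos (by norm_num) σ) _ dg hdlt (finFunctionFinEquiv K)
  rw [hNsum, hdd]
  simp only [dg, Equiv.symm_apply_apply]
  rw [Int.toNat_of_nonneg (hdnn K)]

/-- **Soundness of the shape scan.**  If `coefBound m n < 2^(σ−1)` and `checkShapeCube` passes, then for every `n`-tuple of increasing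
events of `2^{Fin m}`, every axis `e` and every profile `j`, the coefficient line `t ↦ combLine n U e j t` satisfies ENDMIN, ORDER-1 and UNI.
[this work] -/
theorem shape_of_checkShapeCube {σ : ℕ} (hσ : 0 < σ) (hbnd : coefBound m n < 2 ^ (σ - 1)) {KT : ℕ → ℤ}
    (hKT : ∀ T, KT T = (krTB σ (n + 1) m T : ℤ))
    (h : checkShapeCube σ m n KT (krTB σ (n + 1) m (fullN m)) (maskN σ ((n + 1) ^ m)) = true)
    (hn : 1 ≤ n) (U : Fin n → Set (Set (Fin m))) (hU : ∀ i, IsUpperSet (U i)) (e : Fin m) (j : Fin m → ℕ) :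
    (∀ t, t ≤ n → min (combLine n U e j 0) (combLine n U e j n) ≤ combLine n U e j t) ∧
      (combLine n U e j 0 ≤ combLine n U e j 1 ∧ combLine n U e j n ≤ combLine n U e j (n - 1)) ∧
      ∃ mo, mo ≤ n ∧ MonotoneOn (combLine n U e j) (Set.Icc 0 mo) ∧ AntitoneOn (combLine n U e j) (Set.Icc mo n) := by
  by_cases hj : update j e 0 ∈ box (fun _ : Fin m => n)
  swap
  · have h0 : ∀ t, combLine n U e j t = 0 := fun t => by
      rw [combLine_eq_combCoeff]
      refine combCoeff_eq_zero_of_not_mem_box _ fun hjt => hj (mem_box.2 fun i => ?_)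
      by_cases hi : i = e
      · subst hi; simp
      · rw [update_of_ne hi]; have := mem_box.1 hjt i; rwa [update_of_ne hi] at this
    refine ⟨fun t _ => by simp [h0], by simp [h0], 0, Nat.zero_le n, ?_, ?_⟩ <;> intro s _ t _ _ <;> simp [h0]
  -- the family's scan
  set a : Fin n → ℕ := fun i => encA m (U i) with ha
  have hmem : a ∈ tuples (upsN m) n := mem_tuples a fun i => encA_mem_upsN (hU i)
  unfold checkShapeCube at h
  rw [List.all_eq_true] at h
  have hfam := h a hmem
  unfold checkShapeFam at hfam
  simp only [Bool.and_eq_true, decide_eq_true_eq, List.all_eq_true, List.mem_range] at hfam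
  obtain ⟨hZ, hlines⟩ := hfam
  -- the line through `j[e ↦ 0]` along `e`
  set K₀ : Fin m → Fin (n + 1) := profKeyN n (update j e 0) with hK₀
  set p₀ : ℕ := (finFunctionFinEquiv K₀ : ℕ) with hp₀
  have hK₀e : K₀ e = 0 := by
    apply Fin.ext; simp [hK₀, profKeyN]
  have hp₀lt : p₀ < (n + 1) ^ m := (finFunctionFinEquiv K₀).2
  have hp₀dig : p₀ / (n + 1) ^ (e : ℕ) % (n + 1) = 0 := by
    have hd := digit_pos_eq K₀ e
    rw [hK₀e] at hd
    exact hd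
  -- digits of the line are the comb coefficients shifted by `2^(σ−1)`
  set Z : ℤ := sahiKr KT (krTB σ (n + 1) m (fullN m)) n a + (maskN σ ((n + 1) ^ m) : ℤ) with hZdef
  have hline := hlines e e.2 p₀ hp₀lt
  rw [hp₀dig] at hline
  simp only [decide_true, Bool.not_true, Bool.false_or, Bool.and_eq_true] at hline
  obtain ⟨⟨hE, hO⟩, hUn⟩ := hline
  set g : ℕ → ℕ := fun t => digit (2 ^ σ) Z.toNat (p₀ + t * (n + 1) ^ (e : ℕ)) with hg
  have hjt : ∀ {t : ℕ}, t ≤ n → update j e t ∈ box (fun _ : Fin m => n) := fun {t} ht => by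
    rw [mem_box]; intro i
    by_cases hi : i = e
    · subst hi; simpa using ht
    · rw [update_of_ne hi]; have := mem_box.1 hj i; rwa [update_of_ne hi] at this
  have hval : ∀ {t : ℕ}, t ≤ n → (g t : ℝ) = combLine n U e j t + (2 : ℝ) ^ (σ - 1) := by
    intro t ht
    have hpos : p₀ + t * (n + 1) ^ (e : ℕ) = (finFunctionFinEquiv (profKeyN n (update j e t)) : ℕ) := by
      have h1 := pos_update K₀ e ⟨t, Nat.lt_succ_of_le ht⟩
      rw [hK₀e] at h1
      simp only [Fin.val_zero, zero_mul, add_zero] at h1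
      have h2 : update K₀ e ⟨t, Nat.lt_succ_of_le ht⟩ = profKeyN n (update j e t) := by
        funext i
        by_cases hi : i = e
        · subst hi; apply Fin.ext; simp [profKeyN, min_eq_left ht]
        · rw [update_of_ne hi]; apply Fin.ext; simp [hK₀, profKeyN, update_of_ne hi]
      rw [← h2, h1]
    have hd := digit_eq_sahiCoef_add hσ hbnd hKT a hZ (profKeyN n (update j e t))
    rw [← hpos] at hd
    rw [combLine_eq_combCoeff, combCoeff_eq_sahiCoef U (hjt ht)]
    have : (g t : ℝ) = ((g t : ℤ) : ℝ) := by push_cast; rfl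
    rw [this, show (g t : ℤ) = sahiCoef m n a (profKeyN n (update j e t)) + 2 ^ (σ - 1) from hd]
    push_cast
    rfl
  have hle : ∀ {s t : ℕ}, s ≤ n → t ≤ n → (g s ≤ g t ↔ combLine n U e j s ≤ combLine n U e j t) := by
    intro s t hs ht
    rw [← Nat.cast_le (α := ℝ), hval hs, hval ht, add_le_add_iff_right]
  have hlt : ∀ {s t : ℕ}, s ≤ n → t ≤ n → (g s < g t ↔ combLine n U e j s < combLine n U e j t) := by
    intro s t hs ht
    rw [← Nat.cast_lt (α := ℝ), hval hs, hval ht, add_lt_add_iff_right]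
  refine ⟨fun t ht => ?_, ?_, ?_⟩
  · have h1 := endMinB_spec hE ht
    rcases min_le_iff.1 h1 with h2 | h2
    · exact (min_le_left _ _).trans ((hle (Nat.zero_le n) ht).1 h2)
    · exact (min_le_right _ _).trans ((hle le_rfl ht).1 h2)
  · have h1 := ordOneB_spec hO
    exact ⟨(hle (Nat.zero_le n) hn).1 h1.1, (hle le_rfl (Nat.sub_le n 1)).1 h1.2⟩
  · refine unimodal_of_noDescAsc _ n fun i i' hii' hi'n hdesc => ?_
    have hi1 : i + 1 ≤ n := by omega
    exact uniB_spec hUn hii' hi'n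
      ⟨(hlt hi1 (by omega)).2 hdesc.1, (hlt hi'n.le (by omega)).2 hdesc.2⟩

/-- **Soundness of the scan of ONE family** (the per-family form of `shape_of_checkShapeCube`, for scans that enumerate fewer tuples,
e.g. sorted ones): if the family of bitmasks of `U` passes `checkShapeFam`, every coefficient line of `U` satisfies ENDMIN, ORDER-1 and UNI.
[this work] -/
theorem shape_of_checkShapeFam {σ : ℕ} (hσ : 0 < σ) (hbnd : coefBound m n < 2 ^ (σ - 1)) {KT : ℕ → ℤ}
    (hKT : ∀ T, KT T = (krTB σ (n + 1) m T : ℤ)) {U : Fin n → Set (Set (Fin m))}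
    (hfam : checkShapeFam σ m n KT (krTB σ (n + 1) m (fullN m)) (maskN σ ((n + 1) ^ m)) (fun i => encA m (U i)) = true)
    (hn : 1 ≤ n) (e : Fin m) (j : Fin m → ℕ) :
    (∀ t, t ≤ n → min (combLine n U e j 0) (combLine n U e j n) ≤ combLine n U e j t) ∧
      (combLine n U e j 0 ≤ combLine n U e j 1 ∧ combLine n U e j n ≤ combLine n U e j (n - 1)) ∧
      ∃ mo, mo ≤ n ∧ MonotoneOn (combLine n U e j) (Set.Icc 0 mo) ∧ AntitoneOn (combLine n U e j) (Set.Icc mo n) := by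
  -- (any events `U`, increasing or not: the scan hypothesis is about this family) — the argument of `shape_of_checkShapeCube`, repeated
  by_cases hj : update j e 0 ∈ box (fun _ : Fin m => n)
  swap
  · have h0 : ∀ t, combLine n U e j t = 0 := fun t => by
      rw [combLine_eq_combCoeff]
      refine combCoeff_eq_zero_of_not_mem_box _ fun hjt => hj (mem_box.2 fun i => ?_)
      by_cases hi : i = e
      · subst hi; simp
      · rw [update_of_ne hi]; have := mem_box.1 hjt i; rwa [update_of_ne hi] at this
    refine ⟨fun t _ => by simp [h0], by simp [h0], 0, Nat.zero_le n, ?_, ?_⟩ <;> intro s _ t _ _ <;> simp [h0]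
  set a : Fin n → ℕ := fun i => encA m (U i) with ha
  unfold checkShapeFam at hfam
  simp only [Bool.and_eq_true, decide_eq_true_eq, List.all_eq_true, List.mem_range] at hfam
  obtain ⟨hZ, hlines⟩ := hfam
  set K₀ : Fin m → Fin (n + 1) := profKeyN n (update j e 0) with hK₀
  set p₀ : ℕ := (finFunctionFinEquiv K₀ : ℕ) with hp₀
  have hK₀e : K₀ e = 0 := by
    apply Fin.ext; simp [hK₀, profKeyN]
  have hp₀lt : p₀ < (n + 1) ^ m := (finFunctionFinEquiv K₀).2
  have hp₀dig : p₀ / (n + 1) ^ (e : ℕ) % (n + 1) = 0 := by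
    have hd := digit_pos_eq K₀ e
    rw [hK₀e] at hd
    exact hd
  set Z : ℤ := sahiKr KT (krTB σ (n + 1) m (fullN m)) n a + (maskN σ ((n + 1) ^ m) : ℤ) with hZdef
  have hline := hlines e e.2 p₀ hp₀lt
  rw [hp₀dig] at hline
  simp only [decide_true, Bool.not_true, Bool.false_or, Bool.and_eq_true] at hline
  obtain ⟨⟨hE, hO⟩, hUn⟩ := hline
  set g : ℕ → ℕ := fun t => digit (2 ^ σ) Z.toNat (p₀ + t * (n + 1) ^ (e : ℕ)) with hg
  have hjt : ∀ {t : ℕ}, t ≤ n → update j e t ∈ box (fun _ : Fin m => n) := fun {t} ht => by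
    rw [mem_box]; intro i
    by_cases hi : i = e
    · subst hi; simpa using ht
    · rw [update_of_ne hi]; have := mem_box.1 hj i; rwa [update_of_ne hi] at this
  have hval : ∀ {t : ℕ}, t ≤ n → (g t : ℝ) = combLine n U e j t + (2 : ℝ) ^ (σ - 1) := by
    intro t ht
    have hpos : p₀ + t * (n + 1) ^ (e : ℕ) = (finFunctionFinEquiv (profKeyN n (update j e t)) : ℕ) := by
      have h1 := pos_update K₀ e ⟨t, Nat.lt_succ_of_le ht⟩
      rw [hK₀e] at h1
      simp only [Fin.val_zero, zero_mul, add_zero] at h1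
      have h2 : update K₀ e ⟨t, Nat.lt_succ_of_le ht⟩ = profKeyN n (update j e t) := by
        funext i
        by_cases hi : i = e
        · subst hi; apply Fin.ext; simp [profKeyN, min_eq_left ht]
        · rw [update_of_ne hi]; apply Fin.ext; simp [hK₀, profKeyN, update_of_ne hi]
      rw [← h2, h1]
    have hd := digit_eq_sahiCoef_add hσ hbnd hKT a hZ (profKeyN n (update j e t))
    rw [← hpos] at hd
    rw [combLine_eq_combCoeff, combCoeff_eq_sahiCoef U (hjt ht)]
    have : (g t : ℝ) = ((g t : ℤ) : ℝ) := by push_cast; rfl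
    rw [this, show (g t : ℤ) = sahiCoef m n a (profKeyN n (update j e t)) + 2 ^ (σ - 1) from hd]
    push_cast
    rfl
  have hle : ∀ {s t : ℕ}, s ≤ n → t ≤ n → (g s ≤ g t ↔ combLine n U e j s ≤ combLine n U e j t) := by
    intro s t hs ht
    rw [← Nat.cast_le (α := ℝ), hval hs, hval ht, add_le_add_iff_right]
  have hlt : ∀ {s t : ℕ}, s ≤ n → t ≤ n → (g s < g t ↔ combLine n U e j s < combLine n U e j t) := by
    intro s t hs ht
    rw [← Nat.cast_lt (α := ℝ), hval hs, hval ht, add_lt_add_iff_right]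
  refine ⟨fun t ht => ?_, ?_, ?_⟩
  · have h1 := endMinB_spec hE ht
    rcases min_le_iff.1 h1 with h2 | h2
    · exact (min_le_left _ _).trans ((hle (Nat.zero_le n) ht).1 h2)
    · exact (min_le_right _ _).trans ((hle le_rfl ht).1 h2)
  · have h1 := ordOneB_spec hO
    exact ⟨(hle (Nat.zero_le n) hn).1 h1.1, (hle le_rfl (Nat.sub_le n 1)).1 h1.2⟩
  · refine unimodal_of_noDescAsc _ n fun i i' hii' hi'n hdesc => ?_
    have hi1 : i + 1 ≤ n := by omega
    exact uniB_spec hUn hii' hi'n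
      ⟨(hlt hi1 (by omega)).2 hdesc.1, (hlt hi'n.le (by omega)).2 hdesc.2⟩

end SahiComb

end Summit.CriticalPhenomena.PercolationContinuityZ3.Theorems
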